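import Literature.Topology.FourManifolds.FibrewiseMorseFramePeriodic
import HarnessLib

/-!
# Timelike fields along a periodic family of index-one Hessians: the nappe dichotomy

Helper layer `helper_timelike_dichotomy` (generic part) of stub `helper_foldNF_timelike` (the
untwistedness of the round `1`-handle of a genus-one simplified broken Lefschetz fibration),
line `Sketch`, crux `SblfDescent.RungOne`.

(Crux item stmt-SmoothPoincare4-18531; skeleton `Cruxes/RungOne/Lines/Sketch.lean`.)

Let `g : ℝ × V → ℝ` be `C^∞` and `1`-periodic in `t`, with nondegenerate fibre Hessians
`H(t) = ∂ᵤ∂ᵤ g (t, 0)` of index one (`H(0) = c B`, `c > 0`, `B` presented by a Lorentz frame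
`(v₀, b₁, b₂)`).  The set of `H(t)`-timelike vectors is an open double cone with two convex
nappes `N(t)` and `-N(t)` (O'Neill's timecone lemma), varying continuously with `t`.  Along the
compact interval `[0, 1]` an adapted frame (`Splitting.exists_adaptedFrame_Icc`, Hirsch 1976,
Ch. 6 §1) carries `v₀` to a continuous `H(t)`-timelike field `n₀`; comparing the nappes of
`n₀ 1` and `n₀ 0 = v₀` in the cone of `H(1) = H(0)` and closing up inside the (convex) nappe
gives the **nappe dichotomy** (`timelike_dichotomy`): EITHER there is a continuous `1`-periodic
timelike field `w` (the negative line bundle of the family over the circle `ℝ/ℤ` is trivial),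
OR there is a continuous timelike field `n` with `n (t + 1) = -n t` (it is the Möbius bundle).
This is the linear-algebra layer of the untwistedness of the round handle; the geometric layers
exclude the second alternative for the height family of a genus-one SBLF.

## References

* B. O'Neill, *Semi-Riemannian Geometry* (1983), Ch. 5, Lemma 26 (timecones are convex) and
  Lemma 29. [ONeill1983]
* M. W. Hirsch, *Differential Topology*, GTM 33 (1976), Ch. 6 §1. [HirschDT1976]
-/

set_option linter.dupNamespace false

noncomputable section

open scoped Manifold ContDiff Topology
open Set Function Filter Metric Literature.Topology.FourManifolds

namespace Summit.SmoothPoincare4.SmoothPoincare4.Cruxes.RungOne.Sketch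

variable {V : Type*} [NormedAddCommGroup V] [NormedSpace ℝ V]

/-! ### Timecones of an index-one form: the two nappes are convex -/

/-- **Timelike vectors are never orthogonal** (reversed Schwarz inequality): in a Lorentz frame
`(v₀, b₁, b₂)` of the form `B`, if `B (x, x) < 0` and `B (y, y) < 0` then `B (x, y) ≠ 0`.
[cite: ONeill1983, Ch. 5, Lemma 29] -/
theorem lorentz_apply_ne_zero {B : V →L[ℝ] V →L[ℝ] ℝ} {v₀ b₁ b₂ : V}
    (hexp : ∀ x, x = (-B v₀ x) • v₀ + B b₁ x • b₁ + B b₂ x • b₂) {x y : V} (hx : B x x < 0)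
    (hy : B y y < 0) : B x y ≠ 0 := by
  rw [IndexOneForm.apply_eq_of_frame hexp x x] at hx
  rw [IndexOneForm.apply_eq_of_frame hexp y y] at hy
  have key := Splitting.lorentz_pairing_sign hx hy
  rw [← IndexOneForm.apply_eq_of_frame hexp x y] at key
  intro h0
  rw [h0, zero_mul] at key
  exact lt_irrefl _ key

/-- **The nappes of the timecone are convex**: for a symmetric form `B`, if `x`, `y` are
timelike with `B (x, y) < 0` (the same nappe) then every `s x + r y`, `s, r ≥ 0`, `s + r > 0`,
is timelike. [cite: ONeill1983, Ch. 5, Lemma 26] -/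
theorem lorentz_combo_neg {B : V →L[ℝ] V →L[ℝ] ℝ} (hB : ∀ x y, B x y = B y x) {x y : V}
    (hx : B x x < 0) (hy : B y y < 0) (hxy : B x y < 0) {s r : ℝ} (hs : 0 ≤ s) (hr : 0 ≤ r)
    (hsr : 0 < s + r) : B (s • x + r • y) (s • x + r • y) < 0 := by
  have hrw : B (s • x + r • y) (s • x + r • y) =
      s * s * B x x + 2 * (s * r) * B x y + r * r * B y y := by
    simp only [map_add, map_smul, add_apply, smul_apply, smul_eq_mul, hB y x]
    ring
  rw [hrw]
  have h1 : s * s * B x x ≤ 0 := mul_nonpos_of_nonneg_of_nonpos (mul_nonneg hs hs) hx.le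
  have h2 : 2 * (s * r) * B x y ≤ 0 := mul_nonpos_of_nonneg_of_nonpos (by positivity) hxy.le
  have h3 : r * r * B y y ≤ 0 := mul_nonpos_of_nonneg_of_nonpos (mul_nonneg hr hr) hy.le
  rcases lt_or_eq_of_le hs with hs' | hs'
  · have : s * s * B x x < 0 := mul_neg_of_pos_of_neg (mul_pos hs' hs') hx
    linarith
  · have hr' : 0 < r := by rw [← hs'] at hsr; simpa using hsr
    have : r * r * B y y < 0 := mul_neg_of_pos_of_neg (mul_pos hr' hr') hy
    linarith

/-- **The segment between two timelike vectors of the same nappe is timelike.**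
[cite: ONeill1983, Ch. 5, Lemma 26] -/
theorem lorentz_segment_neg {B : V →L[ℝ] V →L[ℝ] ℝ} (hB : ∀ x y, B x y = B y x) {x y : V}
    (hx : B x x < 0) (hy : B y y < 0) (hxy : B x y < 0) {s : ℝ} (hs0 : 0 ≤ s) (hs1 : s ≤ 1) :
    B ((1 - s) • x + s • y) ((1 - s) • x + s • y) < 0 :=
  lorentz_combo_neg hB hx hy hxy (sub_nonneg.2 hs1) hs0 (by linarith)

/-! ### Antiperiodic extension of a path -/

omit [NormedSpace ℝ V] in
/-- **Antiperiodic extension.**  A continuous path `p` on `[0, 1]` with `p 1 = -p 0` extends to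
a continuous `n : ℝ → V` with `n (t + 1) = -n t`, every value of which is `± p r` for some
`r ∈ [0, 1]` congruent to `t` modulo `1` (`n t = q (2 fract (t/2))` for the doubled path `q`
on `[0, 2]`). [folklore] -/
theorem exists_antiperiodicExtension {p : ℝ → V} (hp : ContinuousOn p (Icc 0 1))
    (h01 : p 1 = -p 0) : ∃ n : ℝ → V, Continuous n ∧ (∀ t, n (t + 1) = -n t) ∧
      ∀ t, ∃ (r : ℝ) (z : ℤ), r ∈ Icc (0 : ℝ) 1 ∧ t = r + z ∧ (n t = p r ∨ n t = -p r) := by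
  -- the doubled path `q` on `[0, 2]`
  set q : ℝ → V := fun s => if s ≤ 1 then p s else -p (s - 1) with hq
  have hq2 : ∀ s, 1 < s → q s = -p (s - 1) := fun s hs => by simp [hq, not_le.2 hs]
  have hq1 : ∀ s, s ≤ 1 → q s = p s := fun s hs => by simp [hq, hs]
  have hqc : ContinuousOn q (Icc 0 2) := by
    have hA : ContinuousOn q (Icc 0 1) := hp.congr fun s hs => hq1 s hs.2
    have hB' : ContinuousOn (fun s => -p (s - 1)) (Icc 1 2) := by
      refine (hp.comp (continuous_sub_right (1 : ℝ)).continuousOn fun s hs => ?_).neg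
      exact ⟨by linarith [hs.1], by linarith [hs.2]⟩
    have hB : ContinuousOn q (Icc 1 2) := by
      refine hB'.congr fun s hs => ?_
      rcases eq_or_lt_of_le hs.1 with h | h
      · rw [← h, hq1 1 le_rfl]
        change p 1 = -p (1 - 1)
        rw [sub_self, h01]
      · exact hq2 s h
    rw [← Icc_union_Icc_eq_Icc zero_le_one one_le_two]
    exact hA.union_of_isClosed hB isClosed_Icc isClosed_Icc
  -- `n t = q (2 fract (t / 2))`
  set F : ℝ → V := fun s => q (2 * s) with hF
  have hFc : ContinuousOn F (Icc 0 1) :=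
    hqc.comp (continuousOn_const.mul continuousOn_id) fun s hs =>
      ⟨by linarith [hs.1], by linarith [hs.2]⟩
  have hF01 : F 0 = F 1 := by
    simp only [hF, mul_zero, mul_one]
    rw [hq1 0 zero_le_one, hq2 2 one_lt_two, show (2 : ℝ) - 1 = 1 by norm_num, h01, neg_neg]
  have hnc : Continuous fun t : ℝ => F (Int.fract (t / 2)) :=
    (hFc.comp_fract'' hF01).comp (continuous_id.div_const 2)
  refine ⟨fun t => F (Int.fract (t / 2)), hnc, fun t => ?_, fun t => ?_⟩
  · -- antiperiodicity
    set s : ℝ := Int.fract (t / 2) with hs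
    have hs0 : 0 ≤ s := Int.fract_nonneg _
    have hs1 : s < 1 := Int.fract_lt_one _
    have hfl : (⌊t / 2⌋ : ℝ) + s = t / 2 := by rw [hs]; exact Int.floor_add_fract (t / 2)
    change q (2 * Int.fract ((t + 1) / 2)) = -q (2 * s)
    rcases lt_or_ge s (1 / 2) with h | h
    · have hfr : Int.fract ((t + 1) / 2) = s + 1 / 2 := by
        rw [Int.fract_eq_iff]
        exact ⟨by linarith, by linarith, ⌊t / 2⌋, by linarith⟩
      rw [hfr]
      rcases eq_or_lt_of_le hs0 with h0 | h0
      · rw [← h0]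
        norm_num
        rw [hq1 1 le_rfl, hq1 0 zero_le_one, h01]
      · rw [hq2 _ (by linarith), hq1 _ (by linarith)]
        congr 2
        ring
    · have hfr : Int.fract ((t + 1) / 2) = s - 1 / 2 := by
        rw [Int.fract_eq_iff]
        exact ⟨by linarith, by linarith, ⌊t / 2⌋ + 1, by push_cast; linarith⟩
      rw [hfr]
      rcases eq_or_lt_of_le h with h0 | h0
      · rw [← h0]
        norm_num
        rw [hq1 1 le_rfl, hq1 0 zero_le_one, h01, neg_neg]
      · rw [hq1 _ (by linarith), hq2 _ (by linarith), neg_neg]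
        congr 1
        ring
  · -- every value is `± p r`, `r ≡ t (mod 1)`
    set s : ℝ := Int.fract (t / 2) with hs
    have hs0 : 0 ≤ s := Int.fract_nonneg _
    have hs1 : s < 1 := Int.fract_lt_one _
    have hfl : (⌊t / 2⌋ : ℝ) + s = t / 2 := by rw [hs]; exact Int.floor_add_fract (t / 2)
    change ∃ (r : ℝ) (z : ℤ), r ∈ Icc (0 : ℝ) 1 ∧ t = r + z ∧ (q (2 * s) = p r ∨ q (2 * s) = -p r)
    rcases le_or_gt (2 * s) 1 with h | h
    · exact ⟨2 * s, 2 * ⌊t / 2⌋, ⟨by linarith, h⟩, by push_cast; linarith, Or.inl (hq1 _ h)⟩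
    · exact ⟨2 * s - 1, 2 * ⌊t / 2⌋ + 1, ⟨by linarith, by linarith⟩, by push_cast; linarith,
        Or.inr (hq2 _ h)⟩

/-! ### The nappe dichotomy -/

/-- **The nappe dichotomy for a periodic family of index-one fibre Hessians.**  Let
`g : ℝ × V → ℝ` be `C^∞` and `1`-periodic in `t` (`V` finite-dimensional), with nondegenerate
fibre Hessians `H(t) = ∂ᵤ∂ᵤ g (t, 0)`, and `H(0) = c B` (`c > 0`) for a symmetric `B` presented
by a Lorentz frame `(v₀, b₁, b₂)` (index one).  Then EITHER there is a continuous `1`-periodic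
field `w` of `H(t)`-timelike vectors, OR there is a continuous field `n` of `H(t)`-timelike
vectors with `n (t + 1) = -n t`.  [An adapted frame along `[0, 1]` (Hirsch) transports `v₀` to a
timelike field `n₀` on `[0, 1]`; `n₀ 1` lies in the nappe of `v₀` or of `-v₀` for
`H(1) = H(0)` (O'Neill's timecone lemma), and the segment to `± v₀` inside that convex nappe
closes the field up, periodically or antiperiodically.]
[cite: ONeill1983, Ch. 5, Lemma 26 and Lemma 29] [cite: HirschDT1976, Ch. 6 §1] -/
theorem timelike_dichotomy [FiniteDimensional ℝ V] {g : ℝ × V → ℝ} (hg : ContDiff ℝ ∞ g)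
    (hgT : ∀ (t : ℝ) (u : V), g (t + 1, u) = g (t, u))
    (hH : ∀ (t : ℝ) (a : V),
      (∀ b, fderiv ℝ (fderiv ℝ g) (t, 0) ((0 : ℝ), a) ((0 : ℝ), b) = 0) → a = 0)
    {B : V →L[ℝ] V →L[ℝ] ℝ} (hB : ∀ x y, B x y = B y x) {c : ℝ} (hc : 0 < c)
    (hHB : ∀ a b : V,
      fderiv ℝ (fderiv ℝ g) ((0 : ℝ), (0 : V)) ((0 : ℝ), a) ((0 : ℝ), b) = c * B a b)
    {v₀ b₁ b₂ : V} (hv : B v₀ v₀ = -1)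
    (hexp : ∀ x, x = (-B v₀ x) • v₀ + B b₁ x • b₁ + B b₂ x • b₂) :
    (∃ w : ℝ → V, Continuous w ∧ (∀ t, w (t + 1) = w t) ∧
      ∀ t, fderiv ℝ (fderiv ℝ g) (t, 0) ((0 : ℝ), w t) ((0 : ℝ), w t) < 0) ∨
    (∃ n : ℝ → V, Continuous n ∧ (∀ t, n (t + 1) = -n t) ∧
      ∀ t, fderiv ℝ (fderiv ℝ g) (t, 0) ((0 : ℝ), n t) ((0 : ℝ), n t) < 0) := by
  -- the Hessian family, continuous and `1`-periodic
  obtain ⟨H, hHap⟩ : ∃ H : ℝ → V →L[ℝ] V →L[ℝ] ℝ, ∀ (t : ℝ) (a b : V),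
      H t a b = fderiv ℝ (fderiv ℝ g) (t, 0) ((0 : ℝ), a) ((0 : ℝ), b) :=
    ⟨fun t => (fderiv ℝ (fderiv ℝ g) (t, 0)).bilinearComp (ContinuousLinearMap.inr ℝ ℝ V)
      (ContinuousLinearMap.inr ℝ ℝ V), fun t a b => by simp⟩
  have hHc : ∀ a b : V, Continuous fun t => H t a b := fun a b => by
    have h2 : Continuous (fderiv ℝ (fderiv ℝ g)) :=
      ((hg.fderiv_right (m := ∞) le_rfl).fderiv_right (m := ∞) le_rfl).continuous
    have h3 : Continuous fun t : ℝ => fderiv ℝ (fderiv ℝ g) (t, (0 : V)) :=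
      h2.comp (continuous_id.prodMk continuous_const)
    simp only [hHap]
    exact ((h3.clm_apply continuous_const).clm_apply continuous_const)
  have hHT : ∀ t, H (t + 1) = H t := fun t => by
    ext a b
    rw [hHap, hHap, Splitting.fderiv_fderiv_apply_add_of_periodic hgT]
  have hHn : ∀ (k : ℕ) (t : ℝ), H (t + k) = H t := by
    intro k
    induction k with
    | zero => intro t; simp
    | succ k ih => intro t; push_cast; rw [← add_assoc, hHT, ih]
  have hHz : ∀ (z : ℤ) (t : ℝ), H (t + z) = H t := by
    intro z t
    obtain ⟨k, rfl | rfl⟩ := Int.eq_nat_or_neg z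
    · push_cast; exact hHn k t
    · have := hHn k (t + (-(k : ℤ) : ℤ))
      push_cast at this ⊢
      rw [neg_add_cancel_right] at this
      exact this.symm
  have hH0 : ∀ a b, H 0 a b = c * B a b := fun a b => by rw [hHap]; exact hHB a b
  have hH0neg : ∀ x : V, H 0 x x < 0 ↔ B x x < 0 := fun x => by
    rw [hH0]
    constructor
    · intro h
      by_contra hle
      push Not at hle
      have := mul_nonneg hc.le hle
      linarith
    · exact fun h => mul_neg_of_pos_of_neg hc h
  -- Step 1: an adapted frame along `[0, 1]` and the transported field `n₀ t = Frinv t v₀`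
  obtain ⟨U, Fr, Frinv, hU, hsub, -, hFrinv, hFr0, hri, hli, had⟩ :=
    Splitting.exists_adaptedFrame_Icc hg hH zero_le_one
  have had' : ∀ t ∈ U, ∀ a b, H t a b = H 0 (Fr t a) (Fr t b) := fun t ht a b => by
    rw [hHap, hHap]; exact had t ht a b
  have h0U : (0 : ℝ) ∈ U := hsub ⟨le_rfl, zero_le_one⟩
  have h1U : (1 : ℝ) ∈ U := hsub ⟨zero_le_one, le_rfl⟩
  set n₀ : ℝ → V := fun t => Frinv t v₀ with hn₀
  have hn₀c : ContinuousOn n₀ U := hFrinv.continuousOn.clm_apply continuousOn_const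
  have hn₀0 : n₀ 0 = v₀ := by
    have := hli 0 h0U v₀
    rwa [hFr0, ContinuousLinearMap.id_apply] at this
  have hn₀neg : ∀ t ∈ U, H t (n₀ t) (n₀ t) < 0 := fun t ht => by
    rw [had' t ht, hri t ht, hH0, hv]
    linarith
  -- Step 2: `x = n₀ 1` is `H 0`-timelike; the target `e = ± v₀` in its nappe
  have hx : B (n₀ 1) (n₀ 1) < 0 := by
    rw [← hH0neg, ← hHT 0, zero_add]; exact hn₀neg 1 h1U
  have hvneg : B v₀ v₀ < 0 := by rw [hv]; norm_num
  obtain ⟨e, he, hxe, hecase⟩ : ∃ e : V, B e e < 0 ∧ B (n₀ 1) e < 0 ∧ (e = v₀ ∨ e = -v₀) := by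
    rcases lt_or_gt_of_ne (lorentz_apply_ne_zero hexp hx hvneg) with h | h
    · exact ⟨v₀, hvneg, h, Or.inl rfl⟩
    · exact ⟨-v₀, by simpa using hvneg, by simpa using h, Or.inr rfl⟩
  -- Step 3: the sign condition near `t = 1`, uniformly in the segment parameter
  set Φ : ℝ × ℝ → ℝ := fun q =>
    H q.1 ((1 - q.2) • n₀ q.1 + q.2 • e) ((1 - q.2) • n₀ q.1 + q.2 • e) with hΦ
  have hΦc : ContinuousOn Φ (U ×ˢ univ) := by
    have hseg : ContinuousOn (fun q : ℝ × ℝ => (1 - q.2) • n₀ q.1 + q.2 • e) (U ×ˢ univ) :=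
      (((continuous_const.sub continuous_snd).continuousOn).smul
        (hn₀c.comp continuousOn_fst fun q hq => hq.1)).add
        (continuous_snd.continuousOn.smul continuousOn_const)
    -- `(t, y) ↦ H t y y` is continuous (bilinear in `y`, continuous in `t`)
    have hHc' : Continuous fun q : ℝ × V => H q.1 q.2 q.2 := by
      have h2 : Continuous (fderiv ℝ (fderiv ℝ g)) :=
        ((hg.fderiv_right (m := ∞) le_rfl).fderiv_right (m := ∞) le_rfl).continuous
      have h3 : Continuous fun q : ℝ × V => fderiv ℝ (fderiv ℝ g) (q.1, (0 : V)) :=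
        h2.comp (continuous_fst.prodMk continuous_const)
      have h4 : Continuous fun q : ℝ × V => (((0 : ℝ), q.2) : ℝ × V) :=
        continuous_const.prodMk continuous_snd
      have := (h3.clm_apply h4).clm_apply h4
      simpa only [hHap] using this
    exact hHc'.comp_continuousOn (continuousOn_fst.prodMk hseg)
  set O : Set (ℝ × ℝ) := U ×ˢ univ ∩ Φ ⁻¹' Iio 0 with hO
  have hOo : IsOpen O := hΦc.isOpen_inter_preimage (hU.prod isOpen_univ) isOpen_Iio
  have hsubO : ({(1 : ℝ)} : Set ℝ) ×ˢ Icc (0 : ℝ) 1 ⊆ O := by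
    rintro ⟨t, s⟩ ⟨ht, hs⟩
    rw [mem_singleton_iff] at ht
    subst ht
    refine ⟨⟨h1U, mem_univ _⟩, ?_⟩
    change H 1 ((1 - s) • n₀ 1 + s • e) ((1 - s) • n₀ 1 + s • e) < 0
    have hH1 : H 1 = H 0 := by have := hHT 0; rwa [zero_add] at this
    rw [hH1, hH0neg]
    exact lorentz_segment_neg hB hx he hxe hs.1 hs.2
  obtain ⟨u, w, hu, -, h1u, hIw, huw⟩ :=
    generalized_tube_lemma isCompact_singleton isCompact_Icc hOo hsubO
  obtain ⟨δ₁, hδ₁, hball⟩ := Metric.isOpen_iff.1 hu 1 (h1u rfl)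
  set δ : ℝ := min δ₁ 1 with hδdef
  have hδ : 0 < δ := lt_min hδ₁ one_pos
  have hδ1 : δ ≤ 1 := min_le_right _ _
  have hneg_near : ∀ t s : ℝ, 1 - δ < t → t ≤ 1 → s ∈ Icc (0 : ℝ) 1 →
      H t ((1 - s) • n₀ t + s • e) ((1 - s) • n₀ t + s • e) < 0 := by
    intro t s ht1 ht2 hs
    have htu : t ∈ u := hball (by
      rw [Real.ball_eq_Ioo]
      exact ⟨by linarith [min_le_left δ₁ 1], by linarith⟩)
    have hmem : (t, s) ∈ O := huw ⟨htu, hIw hs⟩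
    exact hmem.2
  -- the cut-off `φ` and the path `p`
  set φ : ℝ → ℝ := fun t => min 1 (max 0 ((t - 1 + δ) / δ)) with hφ
  have hφc : Continuous φ := by
    have h1 : Continuous fun t : ℝ => (t - 1 + δ) / δ := by fun_prop
    exact continuous_const.min (continuous_const.max h1)
  have hφ01 : ∀ t, φ t ∈ Icc (0 : ℝ) 1 := fun t =>
    ⟨le_min zero_le_one (le_max_left _ _), min_le_left _ _⟩
  have hφ0 : ∀ t, t ≤ 1 - δ → φ t = 0 := fun t ht => by
    have : (t - 1 + δ) / δ ≤ 0 := div_nonpos_of_nonpos_of_nonneg (by linarith) hδ.le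
    simp [hφ, max_eq_left this]
  have hφ1 : φ 1 = 1 := by simp [hφ, div_self hδ.ne']
  set p : ℝ → V := fun t => (1 - φ t) • n₀ t + φ t • e with hpdef
  have hpc : ContinuousOn p (Icc 0 1) :=
    (((continuous_const.sub hφc).continuousOn).smul (hn₀c.mono hsub)).add
      (hφc.continuousOn.smul continuousOn_const)
  have hp0 : p 0 = v₀ := by
    simp only [hpdef, hφ0 0 (by linarith), sub_zero, one_smul, zero_smul, add_zero, hn₀0]
  have hp1 : p 1 = e := by simp [hpdef, hφ1]
  have hpneg : ∀ t ∈ Icc (0 : ℝ) 1, H t (p t) (p t) < 0 := by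
    intro t ht
    rcases le_or_gt t (1 - δ) with h | h
    · simp only [hpdef, hφ0 t h, sub_zero, one_smul, zero_smul, add_zero]
      exact hn₀neg t (hsub ht)
    · exact hneg_near t (φ t) h ht.2 (hφ01 t)
  -- Step 4: close up, periodically or antiperiodically
  rcases hecase with rfl | rfl
  · -- same nappe: periodic extension of `p`
    refine Or.inl ⟨fun t => p (Int.fract t), hpc.comp_fract'' (hp0.trans hp1.symm), fun t => by
      simp only [Int.fract_add_one], fun t => ?_⟩
    rw [← hHap]
    have ht : H t = H (Int.fract t) := by
      rw [← hHz ⌊t⌋ (Int.fract t), Int.fract_add_floor]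
    rw [ht]
    exact hpneg _ ⟨Int.fract_nonneg _, (Int.fract_lt_one _).le⟩
  · -- opposite nappe: antiperiodic extension of `p`
    obtain ⟨n, hn, hnT, hval⟩ := exists_antiperiodicExtension hpc (by rw [hp1, hp0])
    refine Or.inr ⟨n, hn, hnT, fun t => ?_⟩
    rw [← hHap]
    obtain ⟨r, z, hr, htr, hnr⟩ := hval t
    have ht : H t = H r := by rw [htr, hHz]
    rw [ht]
    rcases hnr with h | h
    · rw [h]; exact hpneg r hr
    · rw [h]; simpa using hpneg r hr

/-- **The nappe dichotomy, registered form** (`helper_timelike_nappeDichotomy`): for a `C^∞`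
`1`-periodic family `g : ℝ × V → ℝ` with nondegenerate fibre Hessians along the zero section,
`H(0) = c B` (`c > 0`) with `B` symmetric and Lorentz-framed by `(v₀, b₁, b₂)`, either a
continuous `1`-periodic `H(t)`-timelike field exists or a continuous `H(t)`-timelike field `n`
with `n (t + 1) = -n t` exists (`timelike_dichotomy`). [cite: ONeill1983, Ch. 5, Lemma 26 and Lemma 29]
[cite: HirschDT1976, Ch. 6 §1] -/
theorem helper_timelike_nappeDichotomy : ∀ (V : Type) [NormedAddCommGroup V] [NormedSpace ℝ V] [FiniteDimensional ℝ V] (g : ℝ × V → ℝ), ContDiff ℝ ∞ g → (∀ (t : ℝ) (u : V), g (t + 1, u) = g (t, u)) → (∀ (t : ℝ) (a : V), (∀ b, fderiv ℝ (fderiv ℝ g) (t, 0) ((0 : ℝ), a) ((0 : ℝ), b) = 0) → a = 0) → ∀ (B : V →L[ℝ] V →L[ℝ] ℝ), (∀ x y, B x y = B y x) → ∀ (c : ℝ), 0 < c → (∀ a b : V, fderiv ℝ (fderiv ℝ g) ((0 : ℝ), (0 : V)) ((0 : ℝ), a) ((0 : ℝ), b) = c * B a b) → ∀ (v₀ b₁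 b₂ : V), B v₀ v₀ = -1 → (∀ x, x = (-B v₀ x) • v₀ + B b₁ x • b₁ + B b₂ x • b₂) → (∃ w : ℝ → V, Continuous w ∧ (∀ t, w (t + 1) = w t) ∧ ∀ t, fderiv ℝ (fderiv ℝ g) (t, 0) ((0 : ℝ), w t) ((0 : ℝ), w t) < 0) ∨ (∃ n : ℝ → V, Continuous n ∧ (∀ t, n (t + 1) = -n t) ∧ ∀ t, fderiv ℝ (fderiv ℝ g) (t, 0) ((0 : ℝ), n t) ((0 : ℝ), n t) < 0) := by
  intro V _ _ _ g hg hgT hH B hB c hc hHB v₀ b₁ b₂ hv hexp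
  exact timelike_dichotomy hg hgT hH hB hc hHB hv hexp

end Summit.SmoothPoincare4.SmoothPoincare4.Cruxes.RungOne.Sketch

end
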